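import Literature.Computability.Cryptography.LWEPrimePowerSolver
import HarnessLib

/-!
# The Micciancio–Peikert machine as an adaptive strategy: queries computed from the answer history reproduce the solver (MP12 Thm. 3.1, machine bridge)

Topic `Computability/Cryptography` (LWE), grouping namespace `LWE.MP12`, sequel of
`LWEPrimePowerSolver.lean` (`solveDet`, the deterministic solver with the kernel sample `f` called
INSIDE). Proved material (no named fact) towards
`Literature.Computability.Cryptography.blprs_gapSVP_sqrt_dim_to_lwe_classical` (**pqc.S21**),
component Thm. 2.17 = Micciancio–Peikert 2012, Thm. 3.1 (hypothesis `h₂` of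
`BLPRSReduction.…_of_components`).

An oracle machine cannot call `f`: it is an ADAPTIVE TRANSDUCER (`Complexity/AdaptiveFunctions.lean`,
`adFnAlg Q q G`) that, from its input and the bits answered so far, computes the next query, and at
the end the output. This file writes the solver in that form and proves the two agree:

* the call order: the `(e+1)·N'` estimation calls first (index `finProdFinEquiv (j, k)`), then the
  digit calls indexed by `DigIdx = Fin d × Fin e × Fin p × Fin T × Fin 2 × Fin N` through the nested
  `finProdFinEquiv` (`digEquiv`; coordinate-major, then round, candidate, trial, half, block);
* reading the history: `estBits`, `digBit`, the verdicts `stepVerd` and the loop state `Lstate`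
  (the digit loop recomputed from the answered bits), the selected step;
* `queryOf inp hist i` (the `i`-th query block with its coin slice), `closedLoop inp f n` (the
  history after `n` calls when every query is answered by `f`), `outOf inp hist` (the output);
* **`closedLoop_eq_trueHist`**, **`outOf_closedLoop`**: the closed loop answers every call as the
  solver does, and its output IS `solveDet … inp` — by strong induction on the call index: a digit
  query reads the selected step off the estimation bits (all answered earlier) and the loop state
  off the bits of EARLIER rounds of the same coordinate (answered earlier in the coordinate-major
  order), which by induction are the solver's own verdicts.

## References

* D. Micciancio, C. Peikert, *Trapdoors for lattices: simpler, tighter, faster, smaller*, EUROCRYPT 2012,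
  LNCS 7237; full version IACR ePrint 2011/501, §3, proof of Thm. 3.1, pp. 15–16. [MicciancioPeikert2012]
* R. E. Ladner, N. A. Lynch, A. L. Selman, *A comparison of polynomial time reducibilities*,
  Theoret. Comput. Sci. 1 (1975), §2 (adaptive = Turing reductions). [LadnerLynchSelman1975]
-/

noncomputable section

namespace Literature.Computability.Cryptography

namespace LWE

namespace MP12

open Literature.Probability.Distributions

section Strategy

variable {d p e K' m N T N' m' : ℕ} {C : Type} [Inhabited C] (γ : ℝ)
  (f : (Fin m → (Fin d → ZMod (p ^ e)) × ZMod (p ^ e)) → C → Bool)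
  (F : ℕ → (Fin m' → (Fin d → ZMod (p ^ e)) × ZMod (p ^ e)) → (Fin m' → ZMod (p ^ e)) → (Fin d → ZMod (p ^ e)))

/-! ### The call order -/

/-- The index of a digit call: coordinate, round, candidate, trial, half (`x`/`y`), block. [folklore] -/
abbrev DigIdx (d e p T N : ℕ) : Type := Fin d × (Fin e × (Fin p × (Fin T × (Fin 2 × Fin N))))

/-- The number of digit calls. [folklore] -/
abbrev nDig (d e p T N : ℕ) : ℕ := d * (e * (p * (T * (2 * N))))

/-- The number of estimation calls. [folklore] -/
abbrev nEst (e N' : ℕ) : ℕ := (e + 1) * N'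

/-- **The total number of oracle calls.** [cite: MicciancioPeikert2012, Thm. 3.1 proof (pp. 15–16)] -/
abbrev nCalls (d e p T N N' : ℕ) : ℕ := nEst e N' + nDig d e p T N

/-- **The position of a digit call** (coordinate-major mixed radix). [folklore] -/
def digEquiv (d e p T N : ℕ) : DigIdx d e p T N ≃ Fin (nDig d e p T N) :=
  ((Equiv.refl (Fin d)).prodCongr
    (((Equiv.refl (Fin e)).prodCongr
      (((Equiv.refl (Fin p)).prodCongr
        (((Equiv.refl (Fin T)).prodCongr finProdFinEquiv).trans finProdFinEquiv)).trans finProdFinEquiv)).trans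
      finProdFinEquiv)).trans finProdFinEquiv

/-- The position's value: `c·(e·P) + (i'·P + rest)`, `P` the calls per round. [folklore] -/
theorem val_digEquiv (x : DigIdx d e p T N) :
    (digEquiv d e p T N x).val =
      x.1.val * (e * (p * (T * (2 * N)))) + (x.2.1.val * (p * (T * (2 * N))) +
        (x.2.2.1.val * (T * (2 * N)) + (x.2.2.2.1.val * (2 * N) + (x.2.2.2.2.1.val * N + x.2.2.2.2.2.val)))) := by
  obtain ⟨c, i', k, t, h, b⟩ := x
  simp only [digEquiv, Equiv.trans_apply, Equiv.prodCongr_apply, Equiv.coe_refl, Prod.map_apply, id_eq,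
    val_finProdFinEquiv]

/-- **Earlier rounds of the same coordinate come earlier.** [folklore] -/
theorem val_digEquiv_lt_of_round_lt {c : Fin d} {i'' i' : Fin e} (hlt : i'' < i') (y y' : Fin p × (Fin T × (Fin 2 × Fin N))) :
    (digEquiv d e p T N (c, (i'', y))).val < (digEquiv d e p T N (c, (i', y'))).val := by
  rw [val_digEquiv, val_digEquiv]
  simp only
  set P := p * (T * (2 * N)) with hP
  have hy : y.1.val * (T * (2 * N)) + (y.2.1.val * (2 * N) + (y.2.2.1.val * N + y.2.2.2.val)) < P := by
    have h1 := y.1.2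
    have h2 := y.2.1.2
    have h3 := y.2.2.1.2
    have h4 := y.2.2.2.2
    have e3 : y.2.2.1.val * N ≤ 1 * N := Nat.mul_le_mul_right N (by omega)
    have e2 : (y.2.1.val + 1) * (2 * N) ≤ T * (2 * N) := Nat.mul_le_mul_right _ h2
    have e1 : (y.1.val + 1) * (T * (2 * N)) ≤ p * (T * (2 * N)) := Nat.mul_le_mul_right _ h1
    set A := T * (2 * N)
    set y1A := y.1.val * A
    set y2B := y.2.1.val * (2 * N)
    set y3N := y.2.2.1.val * N
    have e2' : y2B + 2 * N ≤ A := by rw [add_mul, one_mul] at e2; exact e2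
    have e1' : y1A + A ≤ P := by rw [add_mul, one_mul] at e1; exact e1
    omega
  have hi : (i''.val + 1) * P ≤ i'.val * P := Nat.mul_le_mul_right _ (by exact hlt)
  set a := i''.val * P
  set b := i'.val * P
  have hi' : a + P ≤ b := by rw [add_mul, one_mul] at hi; exact hi
  have := Nat.zero_le (y'.1.val * (T * (2 * N)) + (y'.2.1.val * (2 * N) + (y'.2.2.1.val * N + y'.2.2.2.val)))
  omega

/-! ### Reading the answer history -/

/-- Bit `i` of the history (`false` beyond its end). [folklore] -/
def bitAt (hist : List Bool) (i : ℕ) : Bool := hist.getD i false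

/-- The estimation bits, by level and repetition. [cite: MicciancioPeikert2012, Thm. 3.1 proof (p. 15)] -/
def estBits (hist : List Bool) : Fin (e + 1) → Fin N' → Bool := fun j k => bitAt hist (finProdFinEquiv (j, k)).val

/-- The bit of a digit call. [folklore] -/
def digBit (hist : List Bool) (x : DigIdx d e p T N) : Bool := bitAt hist (nEst e N' + (digEquiv d e p T N x).val)

open Classical in
/-- **The verdicts of the candidate tests of round `i'` of coordinate `c`, read off the history.**
[cite: MicciancioPeikert2012, Thm. 3.1 proof (p. 16)] -/
def stepVerd (hist : List Bool) (c : Fin d) (i' : Fin e) : Fin p → Bool :=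
  fun k => decide (says0 N γ fun t : Fin T =>
    ((fun b : Fin N => digBit (e := e) (N' := N') hist (c, (i', (k, (t, (0, b)))))),
      (fun b : Fin N => digBit (e := e) (N' := N') hist (c, (i', (k, (t, (1, b))))))))

/-- **The digit loop's state of coordinate `c` after `n` rounds, recomputed from the history.**
[cite: MicciancioPeikert2012, Thm. 3.1 proof (p. 16)] -/
def Lstate (hist : List Bool) (c : Fin d) : ℕ → ℕ
  | 0 => 0
  | i + 1 => if h : i < e then Lstate hist c i + digitOf (stepVerd (p := p) (N := N) (T := T) (N' := N') γ hist c ⟨i, h⟩) * p ^ i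
      else Lstate hist c i

/-- The step selected from the history. [cite: MicciancioPeikert2012, Thm. 3.1 proof (p. 15)] -/
def stepOf (e N' : ℕ) (hist : List Bool) : ℕ := selectStep e N' (estBits (e := e) (N' := N') hist)

/-! ### The queries -/


/-- **The digit query** at position `x` given the selected step `i₀` and the loop state `L`: the
transformed `x`-block (half `0`) or re-spread `y`-unit (half `1`) with its coin slice.
[cite: MicciancioPeikert2012, Thm. 3.1 proof (pp. 15–16)] -/
def digQuery (inp : Input d p e K' m N T N' m' C) (i₀ : ℕ) (x : DigIdx d e p T N) (L : ℕ) :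
    (Fin m → (Fin d → ZMod (p ^ e)) × ZMod (p ^ e)) × C :=
  let c := x.1
  let i' := x.2.1
  let k := x.2.2.1
  let t := x.2.2.2.1
  let h := x.2.2.2.2.1
  let b := x.2.2.2.2.2
  let td := inp.2.1 c i' k t
  let cm := gen p e (i₀ + 1 + i')
  let ts := candShift c i' L k
  if h.val = 0 then (qx td.1 fun q => xmap c cm ts (xpair K' i₀ (td.2.1.1 b q)), td.2.2.1 b)
  else (qy (gen p e (i₀ + 1)) td.1 fun q => ymap c cm ts (ypair K' i₀ (td.2.1.2 b q)), td.2.2.2 b)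


/-- **The `i`-th query with its coin slice, computed from the input and the history**: estimation
queries first, then the digit queries with the selected step and the loop state read off the history
(junk beyond the last call). [cite: MicciancioPeikert2012, Thm. 3.1 proof (pp. 15–16)] -/
def queryOf (inp : Input d p e K' m N T N' m' C) (hist : List Bool) (i : ℕ) :
    (Fin m → (Fin d → ZMod (p ^ e)) × ZMod (p ^ e)) × C :=
  if hi : i < nEst e N' then
    let jk := finProdFinEquiv.symm (⟨i, hi⟩ : Fin ((e + 1) * N'))
    (estBlock K' m jk.1 (inp.1 jk.1 jk.2).1, (inp.1 jk.1 jk.2).2)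
  else if hi' : i - nEst e N' < nDig d e p T N then
    let x := (digEquiv d e p T N).symm ⟨i - nEst e N', hi'⟩
    digQuery inp (stepOf e N' hist) x (Lstate (p := p) (e := e) (N := N) (T := T) (N' := N') γ hist x.1 x.2.1)
  else (fun _ => 0, default)

/-- **The closed loop**: the history after `n` calls when every query is answered by the kernel sample `f`.
[cite: LadnerLynchSelman1975, §2] -/
def closedLoop (inp : Input d p e K' m N T N' m' C) : ℕ → List Bool
  | 0 => []
  | n + 1 => closedLoop inp n ++ [f (queryOf γ inp (closedLoop inp n) n).1 (queryOf γ inp (closedLoop inp n) n).2]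

/-- **The output computed from the input and the full history.** [cite: MicciancioPeikert2012, Thm. 3.1 proof (p. 16)] -/
def outOf (inp : Input d p e K' m N T N' m' C) (hist : List Bool) : Fin d → ZMod (p ^ e) :=
  let i₀ := stepOf e N' hist
  recoverTop (e - i₀) (F (e - i₀)) inp.2.2 fun c =>
    ((Lstate (p := p) (e := e) (N := N) (T := T) (N' := N') γ hist c (e - i₀) : ℕ) : ZMod (p ^ e))

/-! ### The solver's own answers -/

/-- The solver's loop state of coordinate `c` after `n` rounds. [folklore] -/
def Ltrue (inp : Input d p e K' m N T N' m' C) (c : Fin d) (n : ℕ) : ℕ :=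
  digitsDet K' m N T γ (selectStep e N' (estAll K' m N' f inp.1)) f c (inp.2.1 c) n

/-- The solver's `i`-th query. [folklore] -/
def trueQuery (inp : Input d p e K' m N T N' m' C) (i : ℕ) : (Fin m → (Fin d → ZMod (p ^ e)) × ZMod (p ^ e)) × C :=
  if hi : i < nEst e N' then
    let jk := finProdFinEquiv.symm (⟨i, hi⟩ : Fin ((e + 1) * N'))
    (estBlock K' m jk.1 (inp.1 jk.1 jk.2).1, (inp.1 jk.1 jk.2).2)
  else if hi' : i - nEst e N' < nDig d e p T N then
    let x := (digEquiv d e p T N).symm ⟨i - nEst e N', hi'⟩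
    digQuery inp (selectStep e N' (estAll K' m N' f inp.1)) x (Ltrue γ f inp x.1 x.2.1)
  else (fun _ => 0, default)

/-- The solver's `i`-th answer. [folklore] -/
def trueAns (inp : Input d p e K' m N T N' m' C) (i : ℕ) : Bool :=
  f (trueQuery γ f inp i).1 (trueQuery γ f inp i).2

/-- The solver's answers to the first `n` calls. [folklore] -/
def trueHist (inp : Input d p e K' m N T N' m' C) (n : ℕ) : List Bool := (List.range n).map (trueAns γ f inp)

variable {γ f}

/-- Reading the solver's history. [folklore] -/
theorem bitAt_trueHist (inp : Input d p e K' m N T N' m' C) {n i : ℕ} (hi : i < n) :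
    bitAt (trueHist γ f inp n) i = trueAns γ f inp i := by
  unfold bitAt trueHist
  rw [List.getD_eq_getElem _ _ (by simpa using hi)]
  simp

/-- **After the estimation calls the history holds the solver's estimation answers.** [folklore] -/
theorem estBits_trueHist (inp : Input d p e K' m N T N' m' C) {n : ℕ} (hn : nEst e N' ≤ n) :
    estBits (e := e) (N' := N') (trueHist γ f inp n) = estAll K' m N' f inp.1 := by
  funext j k
  unfold estBits
  rw [bitAt_trueHist inp (lt_of_lt_of_le (finProdFinEquiv (j, k)).2 hn), trueAns, trueQuery]
  simp only
  rw [dif_pos (finProdFinEquiv (j, k)).2]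
  simp only [Fin.eta, Equiv.symm_apply_apply]
  rfl

/-- **Earlier-round bits are the solver's verdict bits**, hence the recomputed loop state is the
solver's: if every digit position of coordinate `c` with round `< i'` lies before `n`, then
`Lstate hist c i' = Ltrue c i'` for the solver's history of length `n`. [cite: MicciancioPeikert2012, Thm. 3.1 proof (p. 16)] -/
theorem Lstate_trueHist (inp : Input d p e K' m N T N' m' C) (c : Fin d) {n : ℕ}
    {i' : ℕ} (hcov : ∀ (i'' : Fin e), i''.val < i' → ∀ y : Fin p × (Fin T × (Fin 2 × Fin N)),
      nEst e N' + (digEquiv d e p T N (c, (i'', y))).val < n) :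
    Lstate (p := p) (e := e) (N := N) (T := T) (N' := N') γ (trueHist γ f inp n) c i' = Ltrue γ f inp c i' := by
  induction i' with
  | zero => simp only [Lstate, Ltrue, digitsDet, loopDet]
  | succ i ih =>
    have ih' := ih fun i'' h y => hcov i'' (Nat.lt_succ_of_lt h) y
    set i₀ := selectStep e N' (estAll K' m N' f inp.1) with hi₀
    simp only [Lstate, Ltrue, digitsDet]
    rw [loopDet]
    by_cases hie : i < e
    · rw [dif_pos hie, dif_pos hie, ih']
      change Ltrue γ f inp c i + digitOf (stepVerd (p := p) (N := N) (T := T) (N' := N') γ (trueHist γ f inp n) c ⟨i, hie⟩) * p ^ i =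
        Ltrue γ f inp c i + digitOf (stepDet K' m N T γ i₀ f c (inp.2.1 c ⟨i, hie⟩) i (Ltrue γ f inp c i)) * p ^ i
      congr 3
      funext k
      -- the verdict bits of round `i` read off the history are the solver's
      have hbits : ∀ (t : Fin T) (h2 : Fin 2) (b : Fin N), digBit (e := e) (N' := N') (trueHist γ f inp n) (c, (⟨i, hie⟩, (k, (t, (h2, b))))) =
          f (digQuery inp i₀ (c, (⟨i, hie⟩, (k, (t, (h2, b))))) (Ltrue γ f inp c i)).1
            (digQuery inp i₀ (c, (⟨i, hie⟩, (k, (t, (h2, b))))) (Ltrue γ f inp c i)).2 := by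
        intro t h2 b
        unfold digBit
        rw [bitAt_trueHist inp (hcov ⟨i, hie⟩ (Nat.lt_succ_self i) _), trueAns, trueQuery]
        simp only
        rw [dif_neg (by omega), dif_pos (by simp)]
        simp only [Nat.add_sub_cancel_left, Fin.eta, Equiv.symm_apply_apply, ← hi₀]
      have hv : ∀ t : Fin T,
          ((fun b : Fin N => digBit (e := e) (N' := N') (trueHist γ f inp n) (c, (⟨i, hie⟩, (k, (t, (0, b)))))),
            (fun b : Fin N => digBit (e := e) (N' := N') (trueHist γ f inp n) (c, (⟨i, hie⟩, (k, (t, (1, b))))))) =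
          trialVerdicts K' m N i₀ f c (gen p e (i₀ + 1 + i)) (candShift c i (Ltrue γ f inp c i) k) (inp.2.1 c ⟨i, hie⟩ k t) := by
        intro t
        refine Prod.ext (funext fun b => ?_) (funext fun b => ?_)
        · show digBit (e := e) (N' := N') (trueHist γ f inp n) (c, (⟨i, hie⟩, (k, (t, (0, b))))) = _
          rw [hbits t 0 b]
          rfl
        · show digBit (e := e) (N' := N') (trueHist γ f inp n) (c, (⟨i, hie⟩, (k, (t, (1, b))))) = _
          rw [hbits t 1 b]
          rfl
      have hfun := funext hv
      unfold stepVerd stepDet testDet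
      rw [hfun]
    · rw [dif_neg hie, dif_neg hie, ih']
      rfl

/-- **The query computed from the solver's history is the solver's query.** [cite: MicciancioPeikert2012, Thm. 3.1 proof (pp. 15–16)] -/
theorem queryOf_trueHist (inp : Input d p e K' m N T N' m' C) {n : ℕ} (hn : n < nCalls d e p T N N') :
    queryOf γ inp (trueHist γ f inp n) n = trueQuery γ f inp n := by
  unfold queryOf trueQuery
  by_cases hi : n < nEst e N'
  · rw [dif_pos hi, dif_pos hi]
  · have hi' : n - nEst e N' < nDig d e p T N := by
      have : nCalls d e p T N N' = nEst e N' + nDig d e p T N := rfl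
      omega
    rw [dif_neg hi, dif_neg hi, dif_pos hi', dif_pos hi']
    have hn' : nEst e N' ≤ n := Nat.le_of_not_lt hi
    simp only
    rw [stepOf, estBits_trueHist inp hn', Lstate_trueHist inp _]
    intro i'' hlt y
    set x := (digEquiv d e p T N).symm ⟨n - nEst e N', hi'⟩ with hx
    have hxv : (digEquiv d e p T N x).val = n - nEst e N' := by rw [hx, Equiv.apply_symm_apply]
    have hlt' : i'' < x.2.1 := hlt
    have := val_digEquiv_lt_of_round_lt (d := d) (c := x.1) hlt' y x.2.2
    rw [show (x.1, (x.2.1, x.2.2)) = x from rfl, hxv] at this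
    omega

/-- **The closed loop reproduces the solver's answers.** [cite: LadnerLynchSelman1975, §2] -/
theorem closedLoop_eq_trueHist (inp : Input d p e K' m N T N' m' C) :
    ∀ {n : ℕ}, n ≤ nCalls d e p T N N' → closedLoop γ f inp n = trueHist γ f inp n
  | 0, _ => by simp [closedLoop, trueHist]
  | n + 1, hn => by
    have ih := closedLoop_eq_trueHist inp (Nat.le_of_succ_le hn)
    rw [closedLoop, ih, queryOf_trueHist inp hn, trueHist, trueHist, List.range_succ, List.map_append, List.map_singleton]
    rfl

/-- **The output of the closed loop is the solver's output.** [cite: MicciancioPeikert2012, Thm. 3.1 proof (pp. 15–16)] -/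
theorem outOf_closedLoop (inp : Input d p e K' m N T N' m' C) :
    outOf γ F inp (closedLoop γ f inp (nCalls d e p T N N')) = solveDet K' m N T N' m' γ f F inp := by
  rw [closedLoop_eq_trueHist inp le_rfl, outOf, solveDet]
  have hn : nEst e N' ≤ nCalls d e p T N N' := Nat.le_add_right _ _
  rw [stepOf, estBits_trueHist inp hn]
  congr 1
  funext c
  rw [Lstate_trueHist inp c]
  · rfl
  · intro i'' _ y
    exact Nat.add_lt_add_left (digEquiv d e p T N (c, (i'', y))).2 _

end Strategy

end MP12

end LWE

end Literature.Computability.Cryptography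

end
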